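import Summits.BirchSwinnertonDyer.BirchSwinnertonDyer.Theorems.KolyvaginRoadThreeSchneiderTamAtThreeHeightLogNumerator
import Summits.BirchSwinnertonDyer.BirchSwinnertonDyer.Theorems.KolyvaginRoadThreeSchneiderTamAtThreeOddPrimeClosedForm
import Summits.BirchSwinnertonDyer.Rank1Residual.X11b.RegMultCertificateJoin
import Literature.NumberTheory.EllipticCurves.SteinWuthrich2013.MultiplicativeHeightExistenceProofs
import Summits.BirchSwinnertonDyer.BirchSwinnertonDyer.Theses.KolyvaginRoadThree
import HarnessLib

/-!
# Crux `SchneiderTamAtThree` (item 19154) — THE HEIGHT IS THE LOGARITHM OF THE NUMERATOR, part 4/4: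
# `ĥ₃(P) = log₃ num x(P) + O(‖x(P)‖₃⁻¹)`, the NUMERATOR CRITERION `3^{v₃(den x)} ∤ (num x)² − 1 ⟹
# ĥ₃(P) ≠ 0`, Schneider's binder at `3` from one rational point, and the crux on the numerator sub-locus

HONEST FRAMING (cell `bsd-stepL`, seat `bsd-stepL-tam3-p2` g0, WIDTH-LEVER second lane «closed-form
Schneider local factor at 3 … finite case table proved once»; `--supports stmt-BirchSwinnertonDyer-19154
--as helper`): THEOREMS ONLY; 0 definitions, 0 named facts, 0 sorry; nothing here proves the crux
class-wide, Schneider's conjecture or BSD — the crux stays OPEN (it is the transcendence-type statement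
`Σ²_E(P) ≠ den x(P)` on every admissible point of every curve of the locus, companion file
`KolyvaginRoadThreeSchneiderTamAtThreeOfTateSigma.lean`). What IS proved, class-wide and unconditionally,
is the closed form of the height's leading digits and the resulting decidable sufficient condition:

* `norm_unit_mul_num_sub_one_le` — `U(P)·num x(P) ≡ 1 (mod 3^{2k})`, `U = Σ²/den x`, `3^{2k} ‖ den x`.
* `norm_heightFourOneCoord_sub_padicLog_num_le` — **`‖ĥ₃(P) − log₃ num x(P)‖₃ ≤ ‖x(P)‖₃⁻¹`**: the
  `3`-adic height (SW (4.1), THE canonical one at a non-split `3`) of a rational point of `E₁(ℚ₃)` IS the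
  Iwasawa logarithm of the numerator of its `x`-coordinate, to the depth of the point.
* `norm_heightFourOneCoord_eq_norm_num_sq_sub_one` — if `‖(num x)² − 1‖₃ > ‖x‖₃⁻¹` then
  `‖ĥ₃(P)‖₃ = ‖(num x)² − 1‖₃` exactly; `heightFourOneCoord_ne_zero_of_num_criterion`,
  `…_of_not_pow_dvd` — **`3^{v₃(den x)} ∤ (num x)² − 1 ⟹ ĥ₃(P) ≠ 0`**.
* `regulatorNonvanishingAt_three_of_num_criterion` — for `W` minimal, non-split multiplicative at `3`,
  rank one: ONE admissible rational point passing the criterion gives `RegulatorNonvanishingAt W 3`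
  (Schneider's binder of the class record) — by integer arithmetic alone;
  `regulatorNonvanishingAt_three_of_classX11b_of_num_criterion` (GZK by name for the rank);
  `schneiderTamAtThree_of_num_witnesses` — the crux ⟸ one witness per curve of the locus.

EVIDENCE (numbers, not adjectives): on lane A's REG3CERT∕v1 table (kit j249075; 690 of the 723 TRUE-OPEN
non-split (ram) X11b@3 rows carry the admissible point `Q = (a/e², b/e³)`), the law
`v₃(ĥ₃(Q)) = v₃(a − 1)` if `v₃(a − 1) < 2v₃(e)`, else `v₃(ĥ₃(Q)) ≥ 2v₃(e)` holds in 690/690 rows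
(pre-registered here as a THEOREM, parts 3–4); the criterion fires in 543 rows (79 %), where it replaces
the 50-digit certificate; the other 147 rows (`v₃(ĥ₃) ≥ 2v₃(z)`, a curve invariant) are where no
bounded-precision table decides — the honest residue of the «finite case table» road.

References: [SteinWuthrich2013] §4.1 (4.1), §4.2, Conj. 4.1, §7; [Iwasawa1972PadicL] §4.4;
[Schneider1982PadicHeightI] §1; [KolyvaginEulerSystems1990] Thm. A; tree: parts 1–3, ui-o2
`Uniform/UI/O2SigmaValuation.lean` (`tateSigmaValueSq_ne_zero`, `norm_den_eq_inv_norm`),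
`X11b/RegMultCertificateJoin.lean`, `Theorems/KolyvaginRoadThreeSchneiderTamAtThreeOddPrimeClosedForm.lean`.
-/

noncomputable section

open scoped Classical Nat
open Filter Topology IsUltrametricDist PowerSeries
open WeierstrassCurve Literature.NumberTheory.EllipticCurves
open Literature.NumberTheory.EllipticCurves.SteinWuthrich2013
open Literature.NumberTheory.EllipticCurves.TateCurve
open Literature.NumberTheory.EllipticCurves.Rank1Residual
open Summit.BirchSwinnertonDyer.Uniform.UI.O2

namespace Summit.BirchSwinnertonDyer.Rank1Residual.X11b.RegMult.HeightLogNumerator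

/-! ### §7 Consequences: `U(P)·num x(P) ≡ 1 (mod 3^{2k})`, the height is the logarithm of the
numerator, its exact size, and the NUMERATOR CRITERION for non-vanishing -/

section Consequences

variable {W : WeierstrassCurve ℚ}

/-- `‖log₃ y‖ = ‖y − 1‖` for a principal unit `y` of `ℚ₃` (from the unit form
`‖log₃ A‖ = ‖1 − A²‖` and `‖1 + y‖ = 1`). [cite: Iwasawa1972PadicL, §4.4] -/
theorem norm_padicLog_three_of_norm_sub_one_lt {y : ℚ_[3]} (hy : ‖y - 1‖ < 1) :
    ‖padicLog 3 y‖ = ‖y - 1‖ := by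
  have hy1 : ‖y‖ = 1 := norm_eq_one_of_norm_sub_one_lt_one hy
  rw [SchneiderClosedFormOddPrime.norm_padicLog_of_norm_eq_one (p := 3) (by norm_num) hy1,
    show (3 - 1 : ℕ) = 2 from rfl, show (1 : ℚ_[3]) - y ^ 2 = (1 - y) * (1 + y) by ring, norm_mul,
    norm_sub_rev]
  have h2 : ‖(2 : ℚ_[3])‖ = 1 := by
    simpa using Padic.norm_natCast_eq_one_iff.mpr (show Nat.Coprime 3 2 by decide)
  have : ‖1 + y‖ = 1 := by
    rw [show (1 : ℚ_[3]) + y = 2 + (y - 1) by ring, norm_add_eq_max_of_norm_ne_norm (by rw [h2]; exact hy.ne'),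
      h2, max_eq_left hy.le]
  rw [this, mul_one]

/-- **`U(P)·num x(P) ≡ 1 (mod 3^{2k})`**, `3^{2k} ‖ den x(P)`: with `U(P) = Σ²_E(P)/den x(P)` (a `3`-adic
unit, ui-o2 gen 5/8) and `num x = x·den x`, `‖U(P)·num x(P) − 1‖₃ ≤ ‖x(P)‖₃⁻¹ = ‖den x(P)‖₃` — the
refinement of ui-o2's `norm_tateSigmaValueSq_div_den_mul_num_sub_one_lt_one` (`< 1`) to the full depth
of the point. [cite: SteinWuthrich2013, §4.2] -/
theorem norm_unit_mul_num_sub_one_le [W.IsElliptic] [W.IsGloballyMinimal] (hW : Mult W 3)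
    {q : ℚ_[3]} (hq : ‖q‖ < 1) {x y : ℚ} (hxy : W.toAffine.Nonsingular x y) (hx : 1 < ‖(x : ℚ_[3])‖) :
    ‖tateSigmaValueSq W 3 q x y / ((x.den : ℚ) : ℚ_[3]) * ((x.num : ℚ) : ℚ_[3]) - 1‖ ≤ ‖(x : ℚ_[3])‖⁻¹ := by
  have hd0 : ((x.den : ℚ) : ℚ_[3]) ≠ 0 := by exact_mod_cast x.den_nz
  have hnum : ((x.num : ℚ) : ℚ_[3]) = (x : ℚ_[3]) * ((x.den : ℚ) : ℚ_[3]) := by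
    rw [← Rat.cast_mul, Rat.mul_den_eq_num]
  have e : tateSigmaValueSq W 3 q x y / ((x.den : ℚ) : ℚ_[3]) * ((x.num : ℚ) : ℚ_[3]) =
      (x : ℚ_[3]) * tateSigmaValueSq W 3 q x y := by
    rw [hnum]; field_simp
  rw [e]
  exact norm_x_mul_tateSigmaValueSq_sub_one_le hW hq hxy hx

/-- **THE HEIGHT IS THE LOGARITHM OF THE NUMERATOR, to the depth of the point**: for `W/ℚ` globally
minimal with multiplicative reduction at `3`, any `q ∈ ℚ₃` with `‖q‖₃ < 1` and any rational affine point
`P = (x, y)` with `‖x‖₃ > 1`,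
`‖ĥ₃(P) − log₃ (num x(P))‖₃ ≤ ‖x(P)‖₃⁻¹`  (`ĥ₃ = heightFourOneCoord`, SW's formula (4.1)).
Indeed `ĥ₃(P) − log₃ num x = (log₃ den x − log₃ Σ²) − (log₃ x + log₃ den x) = −log₃(x·Σ²)` and
`‖log₃(x·Σ²)‖ = ‖x·Σ² − 1‖ ≤ ‖x‖⁻¹` (§6; `log₃` is an isometry on `1 + 3ℤ₃`). The `3`-adic analogue of
"the canonical height is the naive height up to `O(1)`": here the error is `O(3^{−2k})` for a point of
level `k`. [cite: SteinWuthrich2013, §4.1 eq. (4.1), §4.2] [cite: Iwasawa1972PadicL, §4.4] -/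
theorem norm_heightFourOneCoord_sub_padicLog_num_le [W.IsElliptic] [W.IsGloballyMinimal] (hW : Mult W 3)
    {q : ℚ_[3]} (hq : ‖q‖ < 1) {x y : ℚ} (hxy : W.toAffine.Nonsingular x y) (hx : 1 < ‖(x : ℚ_[3])‖) :
    ‖heightFourOneCoord W 3 q x y - padicLog 3 ((x.num : ℚ) : ℚ_[3])‖ ≤ ‖(x : ℚ_[3])‖⁻¹ := by
  have hX0 : (x : ℚ_[3]) ≠ 0 := norm_pos_iff.mp (one_pos.trans hx)
  have hd0 : ((x.den : ℚ) : ℚ_[3]) ≠ 0 := by exact_mod_cast x.den_nz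
  have hS0 := tateSigmaValueSq_ne_zero (p := 3) (by norm_num) hW hq hxy hx
  have hnum : ((x.num : ℚ) : ℚ_[3]) = (x : ℚ_[3]) * ((x.den : ℚ) : ℚ_[3]) := by
    rw [← Rat.cast_mul, Rat.mul_den_eq_num]
  have hmain := norm_x_mul_tateSigmaValueSq_sub_one_le hW hq hxy hx
  have hlt : ‖(x : ℚ_[3]) * tateSigmaValueSq W 3 q x y - 1‖ < 1 :=
    hmain.trans_lt (inv_lt_one_of_one_lt₀ hx)
  have e : heightFourOneCoord W 3 q x y - padicLog 3 ((x.num : ℚ) : ℚ_[3]) =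
      -padicLog 3 ((x : ℚ_[3]) * tateSigmaValueSq W 3 q x y) := by
    rw [heightFourOneCoord_eq, hnum, padicLog_mul_holds 3 hX0 hd0, padicLog_mul_holds 3 hX0 hS0]
    ring
  rw [e, norm_neg, norm_padicLog_three_of_norm_sub_one_lt hlt]
  exact hmain

/-- `‖num x‖₃ = 1` for `‖x‖₃ > 1` (`num x = x · den x`, `‖den x‖₃ = ‖x‖₃⁻¹`). [folklore] -/
theorem norm_num_eq_one {x : ℚ} (hx : 1 < ‖(x : ℚ_[3])‖) : ‖((x.num : ℚ) : ℚ_[3])‖ = 1 := by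
  have hnum : ((x.num : ℚ) : ℚ_[3]) = (x : ℚ_[3]) * ((x.den : ℚ) : ℚ_[3]) := by
    rw [← Rat.cast_mul, Rat.mul_den_eq_num]
  rw [hnum, norm_mul, norm_den_eq_inv_norm hx, mul_inv_cancel₀ (one_pos.trans hx).ne']

/-- **EXACT SIZE OF THE HEIGHT FROM THE NUMERATOR**: under the hypotheses of
`norm_heightFourOneCoord_sub_padicLog_num_le`, if `‖(num x)² − 1‖₃ > ‖x‖₃⁻¹` (i.e. `(num x)² ≢ 1`
modulo the `3`-part of `den x`), then `‖ĥ₃(P)‖₃ = ‖(num x)² − 1‖₃` (`‖log₃ a‖ = ‖1 − a²‖` for a unit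
`a`, and the error `O(‖x‖⁻¹)` is smaller). In particular `v₃(ĥ₃(P)) = v₃(num x(P) − 1)` whenever this
is `< v₃(den x(P))` (as `num x ≡ 1 mod 3`). Lane A's table of record (kit j249075, 690 rows with point
data) obeys this law in 690/690 rows; in 543 of them the hypothesis holds, so their certificate is this
one line of integer arithmetic. [cite: SteinWuthrich2013, §4.2, §7] [cite: Iwasawa1972PadicL, §4.4] -/
theorem norm_heightFourOneCoord_eq_norm_num_sq_sub_one [W.IsElliptic] [W.IsGloballyMinimal]
    (hW : Mult W 3) {q : ℚ_[3]} (hq : ‖q‖ < 1) {x y : ℚ} (hxy : W.toAffine.Nonsingular x y)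
    (hx : 1 < ‖(x : ℚ_[3])‖) (hcrit : ‖(x : ℚ_[3])‖⁻¹ < ‖((x.num : ℚ) : ℚ_[3]) ^ 2 - 1‖) :
    ‖heightFourOneCoord W 3 q x y‖ = ‖((x.num : ℚ) : ℚ_[3]) ^ 2 - 1‖ := by
  have hlog : ‖padicLog 3 ((x.num : ℚ) : ℚ_[3])‖ = ‖((x.num : ℚ) : ℚ_[3]) ^ 2 - 1‖ := by
    rw [SchneiderClosedFormOddPrime.norm_padicLog_of_norm_eq_one (p := 3) (by norm_num) (norm_num_eq_one hx),
      show (3 - 1 : ℕ) = 2 from rfl, norm_sub_rev]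
  have herr := norm_heightFourOneCoord_sub_padicLog_num_le hW hq hxy hx
  have hne : ‖padicLog 3 ((x.num : ℚ) : ℚ_[3])‖ ≠
      ‖heightFourOneCoord W 3 q x y - padicLog 3 ((x.num : ℚ) : ℚ_[3])‖ := by
    rw [hlog]; exact (herr.trans_lt hcrit).ne'
  rw [show heightFourOneCoord W 3 q x y = padicLog 3 ((x.num : ℚ) : ℚ_[3]) +
      (heightFourOneCoord W 3 q x y - padicLog 3 ((x.num : ℚ) : ℚ_[3])) by ring,
    norm_add_eq_max_of_norm_ne_norm hne, hlog]
  exact max_eq_left ((herr.trans hcrit.le))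

/-- **THE NUMERATOR CRITERION**: for `W/ℚ` globally minimal with multiplicative reduction at `3`, any
`‖q‖₃ < 1` and any rational point `P = (x,y)` with `‖x‖₃ > 1`: if `(num x)² ≢ 1` modulo the `3`-part
of `den x` (`‖x‖₃⁻¹ < ‖(num x)² − 1‖₃`), then SW's `3`-adic height of `P` is NON-ZERO — a closed-form,
decidable sufficient condition read off ONE rational point, with no `3`-adic analysis.
[cite: SteinWuthrich2013, §4.2, Conj. 4.1] [cite: Schneider1982PadicHeightI, §1] -/
theorem heightFourOneCoord_ne_zero_of_num_criterion [W.IsElliptic] [W.IsGloballyMinimal]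
    (hW : Mult W 3) {q : ℚ_[3]} (hq : ‖q‖ < 1) {x y : ℚ} (hxy : W.toAffine.Nonsingular x y)
    (hx : 1 < ‖(x : ℚ_[3])‖) (hcrit : ‖(x : ℚ_[3])‖⁻¹ < ‖((x.num : ℚ) : ℚ_[3]) ^ 2 - 1‖) :
    heightFourOneCoord W 3 q x y ≠ 0 := by
  rw [← norm_pos_iff, norm_heightFourOneCoord_eq_norm_num_sq_sub_one hW hq hxy hx hcrit]
  exact (inv_pos.mpr (one_pos.trans hx)).trans hcrit

/-- **The criterion in integers**: `‖x‖₃⁻¹ < ‖(num x)² − 1‖₃` holds as soon as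
`3^{v₃(den x)} ∤ (num x)² − 1` (for `‖x‖₃ > 1`; `‖den x‖₃ = 3^{−v₃(den x)}` and
`‖k‖₃ ≤ 3^{−n} ↔ 3ⁿ ∣ k`). [folklore] -/
theorem inv_norm_lt_of_not_pow_dvd {x : ℚ} (hx : 1 < ‖(x : ℚ_[3])‖)
    (h : ¬ ((3 : ℤ) ^ padicValNat 3 x.den ∣ x.num ^ 2 - 1)) :
    ‖(x : ℚ_[3])‖⁻¹ < ‖((x.num : ℚ) : ℚ_[3]) ^ 2 - 1‖ := by
  have hden : ‖(x : ℚ_[3])‖⁻¹ = (3 : ℝ) ^ (-(padicValNat 3 x.den : ℤ)) := by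
    rw [← norm_den_eq_inv_norm hx, Rat.cast_natCast,
      Padic.norm_eq_zpow_neg_valuation (by exact_mod_cast x.den_nz), Padic.valuation_natCast]
    norm_cast
  have hk : ((x.num : ℚ) : ℚ_[3]) ^ 2 - 1 = (((x.num ^ 2 - 1 : ℤ)) : ℚ_[3]) := by push_cast; ring
  rw [hden, hk]
  by_contra hle
  exact h ((Padic.norm_int_le_pow_iff_dvd _ _).mp (not_lt.mp hle))

/-- **The numerator criterion, integer form**: `3^{v₃(den x)} ∤ (num x)² − 1 ⟹ ĥ₃(P) ≠ 0`.
[cite: SteinWuthrich2013, §4.2, Conj. 4.1] -/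
theorem heightFourOneCoord_ne_zero_of_not_pow_dvd [W.IsElliptic] [W.IsGloballyMinimal]
    (hW : Mult W 3) {q : ℚ_[3]} (hq : ‖q‖ < 1) {x y : ℚ} (hxy : W.toAffine.Nonsingular x y)
    (hx : 1 < ‖(x : ℚ_[3])‖) (h : ¬ ((3 : ℤ) ^ padicValNat 3 x.den ∣ x.num ^ 2 - 1)) :
    heightFourOneCoord W 3 q x y ≠ 0 :=
  heightFourOneCoord_ne_zero_of_num_criterion hW hq hxy hx (inv_norm_lt_of_not_pow_dvd hx h)

end Consequences


/-! ### §8 Rank one: Schneider's non-degeneracy at `3` from ONE rational point; the crux on the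
numerator sub-locus -/

section Crux

variable {W : WeierstrassCurve ℚ}

/-- **Schneider's binder at `3` from ONE rational point, by integer arithmetic.** For `W/ℚ` globally
minimal, NON-split multiplicative at `3`, of Mordell–Weil rank one: if some ADMISSIBLE rational point
`P = (x, y)` (non-torsion, `‖x‖₃ > 1`, `z` in the sigma disc, non-singular reduction everywhere) has
`3^{v₃(den x)} ∤ (num x)² − 1`, then `ClassClosure.RegulatorNonvanishingAt W 3` — the per-pair input of
the class record at `3` (both halves; the split half is vacuous). For every Tate parameter `q` and THE
datum `Dh` (`IsMultCanonical Dh q`), `⟨P,P⟩ = ĥ₃(P) ≠ 0` by the numerator criterion, and one anisotropic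
point gives `Reg₃ ≠ 0` in rank one (`schneider_of_isMultCanonical_of_heightFourOne_ne_zero`).
No `3`-adic analysis, no certificate precision: one divisibility of integers read off Cremona's point.
[cite: SteinWuthrich2013, §4.2, Conj. 4.1] [cite: Schneider1982PadicHeightI, §1] -/
theorem regulatorNonvanishingAt_three_of_num_criterion [W.IsElliptic] [W.IsGloballyMinimal]
    (hW : Mult W 3) (hns : ¬ W.HasSplitMultiplicativeReductionAtPrime 3) (hr : W.mordellWeilRank = 1)
    {x y : ℚ} {h : W.toAffine.Nonsingular x y} (hadm : W.IsAdmissible 3 (.some x y h))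
    (hcrit : ¬ ((3 : ℤ) ^ padicValNat 3 x.den ∣ x.num ^ 2 - 1)) :
    X11b.ClassClosure.RegulatorNonvanishingAt W 3 := by
  refine ⟨fun q Dh _ hq1 _ hDh => ?_, fun Dq _ _ => absurd Dq.split hns⟩
  refine X11b.schneider_of_isMultCanonical_of_heightFourOne_ne_zero hr hDh hadm ?_
  rw [heightFourOne_some]
  exact heightFourOneCoord_ne_zero_of_not_pow_dvd hW hq1 h hadm.2.1 hcrit

/-- **The crux `SchneiderTamAtThree` ON THE NUMERATOR SUB-LOCUS is a theorem** (given GZK by name for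
rank one): for every `W` of class X11b at `3` (`r_an = 1`, `3 ∥ N`, `E[3]` irreducible), non-split at
`3`, possessing an admissible rational point whose numerator is not a square root of `1` modulo the
`3`-part of its denominator, `RegulatorNonvanishingAt W 3`. On lane A's table of record (kit j249075:
690 TRUE-OPEN non-split (ram) X11b@3 rows with point data) the tabulated admissible point satisfies the
criterion in 543 rows (79 %); for those classes the 50-digit certificate is replaced by this one-line
divisibility, and the statement covers every conductor. The remaining rows (`v₃(ĥ₃(Q)) ≥ 2v₃(z(Q))`,
a property of the curve, not of the point: `ĥ₃(nQ) = n²ĥ₃(Q)`, `z(nQ) ∼ nz(Q)`) are exactly where the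
height is anomalously divisible and no bounded-precision statement decides. (The (ram) and Tamagawa
binders of the crux are not used.) [cite: SteinWuthrich2013, §4.2, Conj. 4.1]
[cite: KolyvaginEulerSystems1990, Thm. A] -/
theorem regulatorNonvanishingAt_three_of_classX11b_of_num_criterion
    (hGZK : rank_eq_analyticRank_of_analyticRank_le_one) (W : WeierstrassCurve ℚ) [W.IsElliptic]
    [W.IsGloballyMinimal] (hX : Summit.BirchSwinnertonDyer.Rank1Residual.ClassX11b W 3)
    (hns : ¬ W.HasSplitMultiplicativeReductionAtPrime 3)
    {x y : ℚ} {h : W.toAffine.Nonsingular x y} (hadm : W.IsAdmissible 3 (.some x y h))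
    (hcrit : ¬ ((3 : ℤ) ^ padicValNat 3 x.den ∣ x.num ^ 2 - 1)) :
    X11b.ClassClosure.RegulatorNonvanishingAt W 3 :=
  regulatorNonvanishingAt_three_of_num_criterion hX.2.2.1 hns (by rw [(hGZK W hX.1.le).1, hX.1]) hadm hcrit

/-- **`SchneiderTamAtThree` ⟸ one numerator witness per curve** (given GZK): if every curve of the
crux's locus (`ClassX11b W 3`, (ram), non-split at `3`, `3 ∣ ∏ c_ℓ`) has an admissible rational point
with `3^{v₃(den x)} ∤ (num x)² − 1`, the crux holds. CONDITIONAL on the witness hypothesis `hwit`,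
which is a statement about rational points of infinitely many curves (true on 79 % of the tabulated
classes, false as stated for the tabulated point on the rest) — recorded as the exact shape of what a
«finite case table» CAN contribute to this crux. [cite: SteinWuthrich2013, §4.2, Conj. 4.1]
[cite: KolyvaginEulerSystems1990, Thm. A] -/
theorem schneiderTamAtThree_of_num_witnesses (hGZK : rank_eq_analyticRank_of_analyticRank_le_one)
    (hwit : ∀ (W : WeierstrassCurve ℚ) [W.IsElliptic] [W.IsGloballyMinimal],
      Summit.BirchSwinnertonDyer.Rank1Residual.ClassX11b W 3 →
      Literature.NumberTheory.EllipticCurves.Rank1Residual.Ram W 3 →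
      ¬ W.HasSplitMultiplicativeReductionAtPrime 3 → 3 ∣ W.tamagawaProduct →
      ∃ (x y : ℚ) (h : W.toAffine.Nonsingular x y), W.IsAdmissible 3 (.some x y h) ∧
        ¬ ((3 : ℤ) ^ padicValNat 3 x.den ∣ x.num ^ 2 - 1)) :
    Summit.BirchSwinnertonDyer.BirchSwinnertonDyer.Theses.KolyvaginRoadThree.SchneiderTamAtThree := by
  intro W _ _ hX hram hns htam
  obtain ⟨x, y, h, hadm, hcrit⟩ := hwit W hX hram hns htam
  exact regulatorNonvanishingAt_three_of_classX11b_of_num_criterion hGZK W hX hns hadm hcrit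

end Crux

end Summit.BirchSwinnertonDyer.Rank1Residual.X11b.RegMult.HeightLogNumerator

end
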